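import Literature.NumberTheory.EllipticCurves.SubgroupSelmerCocycleCriteriaProofs
import Literature.NumberTheory.EllipticCurves.H1UnramifiedFinite
import Literature.NumberTheory.EllipticCurves.Ribet1981.FiniteTorsionCyclotomic
import Literature.NumberTheory.EllipticCurves.IwasawaCyclotomicProofs
import Literature.NumberTheory.EllipticCurves.SelmerCorankAssembly
import Literature.NumberTheory.EllipticCurves.IwasawaSelmer
import Literature.NumberTheory.EllipticCurves.IwasawaSelmerProofs
import HarnessLib

/-!
# Route `AlignedTransportAtTwo`, crux C2 `MainConjectureOfRankZeroBSDAtTwo` (stmt-BirchSwinnertonDyer-22298):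
# road (b″), descent step (ε) — the kernel of `Sel(E/K_∞^{cyc}) → Sel(E/K(μ_{p^∞}))` is FINITE
# (inflation–restriction along a finite-index normal subgroup; Ribet 1981 for the torsion)

Width seat `bsd-line-att-p4` g2 (cell `bsd-f1-sign2`; `--supports` stmt-BirchSwinnertonDyer-22298; closes nothing).
HONEST FRAMING: THEOREMS ONLY — no definition, no named fact, no instance, no `sorry`; BSD is NOT proved by any of
this. The one printed input is DISPLAYED as a hypothesis: `Ribet1981.thm1_finite_primaryTorsion_cyclotomic`
(`E(K(μ_{p^∞}))[p^∞]` finite; Ribet 1981 / Imai–Serre), a statement-only fact of the tree.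

## Why this file

The typed witness of stub K₂″ (`stub_katoCoinvDataQiAtTwo`) of the lead's road (b″) needs, besides Kato's printed
statements over `K_∞ = ℚ(ζ_{2^∞})`, a DESCENT map `fd : X(E/K_∞)_Δ → X(E/ℚ_∞)` with FINITE COKERNEL — the Pontryagin
dual of «`ker(res : Sel(E/ℚ_∞) → Sel(E/K_∞))` is finite» (the lead's (ε), bus 2026-08-28T01:32:49Z, «folklore»).
`K_∞ = ℚ_∞(i) = ℚ(μ_{2^∞})` is the fixed field of `ker χ₂ ≤ ker κ = Gal(ℚ̄/ℚ_∞)` (index `2 = #μ(ℤ₂)`), so in the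
tree's Γ_ℚ-internal model (`WeierstrassCurve.selmerGroupOver W 2 H` for `H = ker χ₂`, on which `Δ` acts by
`conjH1` of a complex conjugation — unlike the `K`-framework `V'.SelmerDualData` of
`Kato2004.charIdeal_dvd_padicLFunction_cyclotomicFour_two`, which carries no `Δ`-action) the statement is an
instance of INFLATION–RESTRICTION: for `H₁ ⊴ H₂` of finite index and a discrete `H₂`-module `M` with `M^{H₁}`
finite, `ker(H¹(H₂, M) → H¹(H₁, M)) ↪ {maps H₂/H₁ → M^{H₁}}` is finite. Here `M^{H₁} = E(K(μ_{p^∞}))[p^∞]` is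
finite by Ribet 1981 (tree fact `Ribet1981.thm1_finite_primaryTorsion_cyclotomic`). Any `K`, any `p`.

## What is proved

* §1 (any topological group `G`, discrete `G`-module `M` with continuous orbit maps, subgroups `H₁ ≤ H₂` of `G`
  with `H₁` normalised by `H₂`, `[H₂ : H₁] < ∞`, `M^{H₁}` finite) `finite_ker_resOfLe`:
  **`{c ∈ H¹(H₂, M) | res_{H₁} c = 0}` is finite.** Proof on explicit continuous crossed homomorphisms
  (`oneCocycleClass_surjective`, `CocycleCriteria.resOfLe_oneCocycleClass_eq_zero_iff`): a kernel class has a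
  representative vanishing on `H₁`; such a cocycle is constant on the cosets of `H₁` with values in `M^{H₁}`, and
  is recovered from its values on coset representatives.
* §2 (number field `K`, prime `p`, elliptic `W`, `κ` the CYCLOTOMIC `ℤ_p`-extension) `ker_cyclotomicCharacter_le_kerSubgroup`
  (`ker χ_p ≤ ker κ`), `finiteIndex_ker_cyclotomicCharacter` (`[ker κ : ker χ_p] < ∞`, from the finiteness of
  `μ(ℤ_p)`, `PadicInt.finite_torsion_units`), and **`finite_ker_res_kerCyclotomicCharacter`**: granted Ribet 1981,
  `{c ∈ H¹(K_∞^{cyc}, E[p^∞]) | res c = 0 in H¹(K(μ_{p^∞}), E[p^∞])}` is finite; a fortiori on the Selmer group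
  (`finite_ker_res_selmerInfty`). For `K = ℚ`, `p = 2` this is (ε): `coker fd` is finite.

References: J.-P. Serre, *Galois Cohomology*, I.§2.6 (inflation–restriction), I.§5.1; K. A. Ribet, appendix to
Katz–Lang, L'Enseignement Math. 27 (1981) 315–319, Thm. 1; R. Greenberg, LNM 1716 (1999), §3 Lemma 3.1 (the same
argument for the layers `K_n ⊆ K_∞`).
-/

set_option autoImplicit false
-- the Theorems namespace of this sub repeats the summit name by design (D-0017 nested layout)
set_option linter.dupNamespace false

noncomputable section

open scoped Classical

namespace Summit.BirchSwinnertonDyer.BirchSwinnertonDyer.Theorems.AlignedTransportAtTwoFineRoad.InfRes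

open Literature.NumberTheory.EllipticCurves Literature.NumberTheory.GaloisRepresentations

universe u

/-! ## §1 Inflation–restriction along a finite-index normal subgroup: the kernel of restriction is finite -/

section Generic

variable {G : Type u} [Group G] [TopologicalSpace G] [IsTopologicalGroup G]
  {M : Type u} [AddCommGroup M] [DistribMulAction G M] [TopologicalSpace M] [DiscreteTopology M]

/-- **Inflation–restriction, finite form.** Let `H₁ ≤ H₂` be subgroups of a topological group `G` with `H₁`
normalised by `H₂` and of finite index in it, and `M` a discrete `G`-module with continuous orbit maps whose
`H₁`-invariants are finite. Then the classes of `H¹(H₂, M)` restricting to `0` in `H¹(H₁, M)` form a FINITE set (they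
inflate from `H¹(H₂/H₁, M^{H₁})`: a kernel class is represented by a continuous crossed homomorphism vanishing on
`H₁`, which is constant on `H₁`-cosets with values in `M^{H₁}`). [cite: SerreGaloisCohomology1997, I §2.6 (inflation–restriction) and I §5.1] -/
theorem finite_ker_resOfLe {H₁ H₂ : Subgroup G} (hle : H₁ ≤ H₂)
    (hnorm : ∀ g ∈ H₂, ∀ h ∈ H₁, g⁻¹ * h * g ∈ H₁) (hind : (H₁.subgroupOf H₂).FiniteIndex)
    (hcont : ∀ m : M, Continuous fun g : G ↦ g • m)
    (hfix : Finite (FixedPoints.addSubgroup H₁ M)) :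
    Set.Finite {c : subgroupH1 H₂ M | resOfLe M hle c = 0} := by
  set U : Subgroup H₂ := H₁.subgroupOf H₂ with hU
  haveI : U.FiniteIndex := hind
  haveI : Finite (FixedPoints.addSubgroup H₁ M) := hfix
  -- Step 1: every kernel class has a representative vanishing on `H₁`
  have key : ∀ c : {c : subgroupH1 H₂ M | resOfLe M hle c = 0},
      ∃ ψ : contOneCocycles (discreteTopRep H₂ M),
        oneCocycleClass _ ψ = c.1 ∧ ∀ x : H₁, ψ.1 (Subgroup.inclusion hle x) = 0 := by
    rintro ⟨c, hc⟩
    obtain ⟨z, rfl⟩ := oneCocycleClass_surjective (discreteTopRep H₂ M) c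
    obtain ⟨a, ha⟩ := (CocycleCriteria.resOfLe_oneCocycleClass_eq_zero_iff hle z).mp hc
    -- the principal crossed homomorphism of `a` on `H₂`
    let π : contOneCocycles (discreteTopRep H₂ M) :=
      ⟨⟨fun g : H₂ ↦ (g : G) • a - a, ((hcont a).comp continuous_subtype_val).sub continuous_const⟩,
        fun g h ↦ by
          change ((g * h : H₂) : G) • a - a =
            ((g : G) • a - a) + (discreteTopRep H₂ M).ρ g (((h : G) • a - a))
          rw [discreteTopRep_ρ_apply, Subgroup.smul_def, Subgroup.coe_mul, mul_smul, smul_sub]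
          abel⟩
    have hπ0 : oneCocycleClass _ π = 0 :=
      (oneCocycleClass_eq_zero_iff _ π).mpr ⟨a, fun g ↦ by rw [discreteTopRep_ρ_apply, Subgroup.smul_def]; rfl⟩
    refine ⟨z - π, ?_, fun x ↦ ?_⟩
    · rw [oneCocycleClass_sub, hπ0, sub_zero]
    · change z.1 (Subgroup.inclusion hle x) - (((Subgroup.inclusion hle x : H₂) : G) • a - a) = 0
      rw [ha x, Subgroup.coe_inclusion, sub_self]
  choose ψ hψc hψ0 using key
  -- Step 2: such representatives are constant on `U`-cosets …
  have hcoset : ∀ c (g k : H₂), k ∈ U → (ψ c).1 (g * k) = (ψ c).1 g := by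
    intro c g k hk
    have hk' : (k : G) ∈ H₁ := Subgroup.mem_subgroupOf.mp hk
    have h0 : (ψ c).1 k = 0 := by
      have e : Subgroup.inclusion hle ⟨(k : G), hk'⟩ = k := Subtype.ext rfl
      rw [← e]
      exact hψ0 c ⟨(k : G), hk'⟩
    rw [(ψ c).2 g k, h0, map_zero, add_zero]
  -- … with values in `M^{H₁}`
  have hinv : ∀ c (g : H₂) (h : H₁), h • (ψ c).1 g = (ψ c).1 g := by
    intro c g h
    set h' : H₂ := Subgroup.inclusion hle h with hh'
    have h1 : (ψ c).1 (h' * g) = (discreteTopRep H₂ M).ρ h' ((ψ c).1 g) := by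
      rw [(ψ c).2 h' g, hψ0 c h, zero_add]
    have hmem : g⁻¹ * h' * g ∈ U := by
      rw [hU, Subgroup.mem_subgroupOf]
      exact hnorm g g.2 h h.2
    have h2 : h' * g = g * (g⁻¹ * h' * g) := by group
    rw [h2, hcoset c g _ hmem, discreteTopRep_ρ_apply, Subgroup.smul_def] at h1
    rw [Subgroup.smul_def]
    exact h1.symm
  -- Step 3: the values on coset representatives determine the class
  let F : {c : subgroupH1 H₂ M | resOfLe M hle c = 0} → (H₂ ⧸ U) → FixedPoints.addSubgroup H₁ M :=
    fun c q ↦ ⟨(ψ c).1 q.out, (FixedPoints.mem_addSubgroup H₁ M _).mpr fun h ↦ hinv c q.out h⟩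
  have hF : Function.Injective F := by
    intro c c' hcc'
    have hψ : ψ c = ψ c' := by
      apply Subtype.ext
      ext g
      obtain ⟨k, hk⟩ := QuotientGroup.mk_out_eq_mul U g
      have e1 : (ψ c).1 g = (ψ c).1 ((QuotientGroup.mk g : H₂ ⧸ U).out) := by
        rw [hk, hcoset c g k k.2]
      have e2 : (ψ c').1 g = (ψ c').1 ((QuotientGroup.mk g : H₂ ⧸ U).out) := by
        rw [hk, hcoset c' g k k.2]
      have h := congrArg (fun f ↦ ((f (QuotientGroup.mk g) : FixedPoints.addSubgroup H₁ M) : M)) hcc'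
      change (ψ c).1 ((QuotientGroup.mk g : H₂ ⧸ U).out) = (ψ c').1 ((QuotientGroup.mk g : H₂ ⧸ U).out) at h
      rw [e1, e2, h]
    apply Subtype.ext
    rw [← hψc c, ← hψc c', hψ]
  haveI : Finite {c : subgroupH1 H₂ M | resOfLe M hle c = 0} := Finite.of_injective F hF
  exact Set.toFinite _

end Generic

/-! ## §2 The cyclotomic case: `ker χ_p ≤ ker κ` of finite index, `E(K(μ_{p^∞}))[p^∞]` finite (Ribet 1981) -/

section Cyclotomic

open WeierstrassCurve

variable {K : Type} [Field K] [NumberField K] {p : ℕ} [Fact p.Prime] (κ : ZpExtension K p)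

omit [NumberField K] in
/-- For the CYCLOTOMIC `ℤ_p`-extension, `Gal(K̄/K(μ_{p^∞})) = ker χ_p ≤ ker κ = Gal(K̄/K_∞)`
(`κ.IsCyclotomic`: `ker κ = χ_p⁻¹(μ(ℤ_p))` and `1 ∈ μ(ℤ_p)`). [cite: Washington1997, §13.1] -/
theorem ker_cyclotomicCharacter_le_kerSubgroup (hκ : κ.IsCyclotomic) :
    (GaloisRep.cyclotomicCharacter K p).toMonoidHom.ker ≤ κ.kerSubgroup := by
  intro σ hσ
  rw [show κ.kerSubgroup = _ from hκ, Subgroup.mem_comap]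
  rw [MonoidHom.mem_ker] at hσ
  rw [hσ]
  exact one_mem _

omit [NumberField K] in
/-- `[ker κ : ker χ_p] < ∞` for the cyclotomic `ℤ_p`-extension: `χ_p` maps `ker κ` into the FINITE torsion subgroup
`μ(ℤ_p)` of `ℤ_pˣ` (`PadicInt.finite_torsion_units`) with kernel `ker χ_p`. [cite: Washington1997, §13.1]
[cite: Serre1973, Ch. II §3.1 Prop. 7, §3.2 Prop. 8] -/
theorem finiteIndex_ker_cyclotomicCharacter (hκ : κ.IsCyclotomic) :
    (((GaloisRep.cyclotomicCharacter K p).toMonoidHom.ker).subgroupOf κ.kerSubgroup).FiniteIndex := by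
  set χ := (GaloisRep.cyclotomicCharacter K p).toMonoidHom with hχ
  -- `χ` restricted to `ker κ`
  let f : κ.kerSubgroup →* ℤ_[p]ˣ := χ.comp κ.kerSubgroup.subtype
  have hker : χ.ker.subgroupOf κ.kerSubgroup = f.ker := by
    ext x
    rw [Subgroup.mem_subgroupOf, MonoidHom.mem_ker, MonoidHom.mem_ker]
    rfl
  -- its range lies in the finite torsion subgroup
  have hle' : κ.kerSubgroup ≤ (CommGroup.torsion ℤ_[p]ˣ).comap χ := le_of_eq hκ
  have hrange : (f.range : Set ℤ_[p]ˣ) ⊆ (CommGroup.torsion ℤ_[p]ˣ : Set ℤ_[p]ˣ) := by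
    rintro _ ⟨x, rfl⟩
    exact Subgroup.mem_comap.mp (hle' x.2)
  haveI : Finite f.range :=
    Set.finite_coe_iff.mpr ((PadicInt.finite_torsion_units (p := p)).subset hrange)
  haveI : Finite (κ.kerSubgroup ⧸ f.ker) :=
    Finite.of_equiv f.range (QuotientGroup.quotientKerEquivRange f).symm.toEquiv
  rw [hker]
  exact Subgroup.finiteIndex_of_finite_quotient

/-- **(ε), the global half, modulo Ribet 1981.** For an elliptic curve `E = W` over a number field `K`, a prime
`p` and the cyclotomic `ℤ_p`-extension `K_∞ = K̄^{ker κ}`: granted `Ribet1981.thm1_finite_primaryTorsion_cyclotomic`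
(`E(K(μ_{p^∞}))[p^∞]` finite), the classes of `H¹(K_∞, E[p^∞])` that restrict to `0` in `H¹(K(μ_{p^∞}), E[p^∞])`
form a FINITE set (inflation–restriction along `Gal(K(μ_{p^∞})/K_∞) ↪ μ(ℤ_p)`). For `K = ℚ`, `p = 2`:
`K(μ_{2^∞}) = ℚ(ζ_{2^∞}) = ℚ_∞(i)` and this is the finiteness of the cokernel of the descent map
`fd : X(E/ℚ(ζ_{2^∞}))_Δ → X(E/ℚ_∞)` of road (b″). [cite: Ribet1981CyclotomicTorsion, Thm. 1 and Thm. 3, pp. 315–316]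
[cite: SerreGaloisCohomology1997, I §2.6 (inflation–restriction)] -/
theorem finite_ker_res_kerCyclotomicCharacter (hRibet : Ribet1981.thm1_finite_primaryTorsion_cyclotomic)
    (W : WeierstrassCurve K) [W.IsElliptic] (hκ : κ.IsCyclotomic) :
    Set.Finite {c : W.subgroupH1 p κ.kerSubgroup |
      W.resOfLe p (ker_cyclotomicCharacter_le_kerSubgroup κ hκ) c = 0} := by
  refine finite_ker_resOfLe (M := W.geomPrimaryTorsion p) (ker_cyclotomicCharacter_le_kerSubgroup κ hκ)
    (fun g _ h hh ↦ (MonoidHom.normal_ker _).conj_mem' h hh g) (finiteIndex_ker_cyclotomicCharacter κ hκ)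
    (fun m ↦ W.continuous_smul_geomPrimaryTorsion p m) ?_
  exact hRibet K W p

/-- **(ε) on the Selmer group.** Granted Ribet 1981: the kernel of the restriction
`Sel_{p^∞}(E/K_∞) → H¹(K(μ_{p^∞}), E[p^∞])` (hence of `Sel(E/K_∞) → Sel(E/K(μ_{p^∞}))`) is finite.
[cite: Ribet1981CyclotomicTorsion, Thm. 1, pp. 315–316] [cite: GreenbergLNM1716, §3 Lemma 3.1 (the argument)] -/
theorem finite_ker_res_selmerInfty (hRibet : Ribet1981.thm1_finite_primaryTorsion_cyclotomic)
    (W : WeierstrassCurve K) [W.IsElliptic] (hκ : κ.IsCyclotomic) :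
    Set.Finite {c : W.subgroupH1 p κ.kerSubgroup | c ∈ W.selmerInfty κ ∧
      W.resOfLe p (ker_cyclotomicCharacter_le_kerSubgroup κ hκ) c = 0} :=
  (finite_ker_res_kerCyclotomicCharacter κ hRibet W hκ).subset fun _ hc ↦ hc.2

end Cyclotomic

/-! ## §3 Local form: along `ker χ_p ⊓ D ≤ ker κ ⊓ D` for any subgroup `D` (e.g. a decomposition group) -/

section Local

open WeierstrassCurve

variable {K : Type} [Field K] [NumberField K] {p : ℕ} [Fact p.Prime] (κ : ZpExtension K p)

omit [NumberField K] in
/-- `[ker κ ⊓ D : ker χ_p ⊓ D] < ∞` for the cyclotomic `ℤ_p`-extension and ANY subgroup `D ≤ Γ_K`: `χ_p` maps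
`ker κ ⊓ D` into the finite group `μ(ℤ_p)` with kernel `ker χ_p ⊓ D`. [cite: Washington1997, §13.1]
[cite: Serre1973, Ch. II §3.1 Prop. 7, §3.2 Prop. 8] -/
theorem finiteIndex_ker_cyclotomicCharacter_inf (hκ : κ.IsCyclotomic)
    (D : Subgroup (Field.absoluteGaloisGroup K)) :
    ((((GaloisRep.cyclotomicCharacter K p).toMonoidHom.ker ⊓ D).subgroupOf (κ.kerSubgroup ⊓ D))).FiniteIndex := by
  set χ := (GaloisRep.cyclotomicCharacter K p).toMonoidHom with hχ
  let f : ↥(κ.kerSubgroup ⊓ D) →* ℤ_[p]ˣ := χ.comp (κ.kerSubgroup ⊓ D).subtype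
  have hker : (χ.ker ⊓ D).subgroupOf (κ.kerSubgroup ⊓ D) = f.ker := by
    ext x
    rw [Subgroup.mem_subgroupOf, Subgroup.mem_inf, MonoidHom.mem_ker, MonoidHom.mem_ker]
    exact ⟨fun h ↦ h.1, fun h ↦ ⟨h, x.2.2⟩⟩
  have hle' : κ.kerSubgroup ≤ (CommGroup.torsion ℤ_[p]ˣ).comap χ := le_of_eq hκ
  have hrange : (f.range : Set ℤ_[p]ˣ) ⊆ (CommGroup.torsion ℤ_[p]ˣ : Set ℤ_[p]ˣ) := by
    rintro _ ⟨x, rfl⟩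
    exact Subgroup.mem_comap.mp (hle' x.2.1)
  haveI : Finite f.range :=
    Set.finite_coe_iff.mpr ((PadicInt.finite_torsion_units (p := p)).subset hrange)
  haveI : Finite (↥(κ.kerSubgroup ⊓ D) ⧸ f.ker) :=
    Finite.of_equiv f.range (QuotientGroup.quotientKerEquivRange f).symm.toEquiv
  rw [hker]
  exact Subgroup.finiteIndex_of_finite_quotient

omit [NumberField K] in
/-- **The LOCAL inflation–restriction defect is finite.** For any subgroup `D ≤ Γ_K` (in road (b″): the
decomposition group of the prime above `2`), granted that the `p`-power torsion points fixed by `ker χ_p ⊓ D` are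
finite — for `D = D_v`, `v ∣ p` of GOOD reduction this is `E(K_v(μ_{p^∞}))[p^∞]` finite, Imai 1975 (Proc. Japan Acad.
51, Theorem p. 12; not a tree fact, DISPLAYED here as `hfix`) — the classes of `H¹(ker κ ⊓ D, E[p^∞])` restricting to
`0` on `ker χ_p ⊓ D` form a finite set. With `D = D_w`, `w ∣ 2`, `K = ℚ`: this is the group
`H¹(Δ_w, E(K_{∞,w})[2^∞])` controlling «classes of `Sel(E/ℚ_∞)` that become FINE over `ℚ(ζ_{2^∞})`», i.e. the
finiteness `hdef` of `…FineRoadArchSquare` / ARCH-BALANCE notes (b). [cite: SerreGaloisCohomology1997, I §2.6 (inflation–restriction)]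
[cite: Imai1975, Theorem p. 12 (good reduction; the local precursor of Ribet 1981)] -/
theorem finite_ker_res_kerCyclotomicCharacter_inf (W : WeierstrassCurve K) [W.IsElliptic] (hκ : κ.IsCyclotomic)
    (D : Subgroup (Field.absoluteGaloisGroup K))
    (hfix : Finite (FixedPoints.addSubgroup
      ↥((GaloisRep.cyclotomicCharacter K p).toMonoidHom.ker ⊓ D) (W.geomPrimaryTorsion p))) :
    Set.Finite {c : W.subgroupH1 p (κ.kerSubgroup ⊓ D) |
      W.resOfLe p (inf_le_inf_right D (ker_cyclotomicCharacter_le_kerSubgroup κ hκ)) c = 0} :=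
  finite_ker_resOfLe (M := W.geomPrimaryTorsion p)
    (inf_le_inf_right D (ker_cyclotomicCharacter_le_kerSubgroup κ hκ))
    (fun g hg h hh ↦ ⟨(MonoidHom.normal_ker _).conj_mem' h hh.1 g,
      D.mul_mem (D.mul_mem (D.inv_mem hg.2) hh.2) hg.2⟩)
    (finiteIndex_ker_cyclotomicCharacter_inf κ hκ D) (fun m ↦ W.continuous_smul_geomPrimaryTorsion p m) hfix

end Local

/-! ## §4 The restriction lands in the `Gal(K(μ_{p^∞})/K_∞^{cyc})`-invariant Selmer classes -/

section Invariants

open WeierstrassCurve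

variable {K : Type} [Field K] [NumberField K] {p : ℕ} [Fact p.Prime] (κ : ZpExtension K p)

/-- **The descent map of road (b″), source side, in the Γ_K-internal model.** For the cyclotomic `ℤ_p`-extension
and an elliptic `W`: the restriction `res : H¹(K_∞^{cyc}, E[p^∞]) → H¹(K(μ_{p^∞}), E[p^∞])` along `ker χ_p ≤ ker κ`
carries `Sel_{p^∞}(E/K_∞^{cyc})` into `Sel_{p^∞}(E/K(μ_{p^∞}))` (tree: `resOfLe_mem_selmerGroupOver`), its image is
FIXED by `conj_σ` for every `σ ∈ ker κ` (tree: `conjH1_resOfLe_of_mem`; i.e. it lies in the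
`Gal(K(μ_{p^∞})/K_∞^{cyc}) ↪ μ(ℤ_p)`-invariants; for
`K = ℚ`, `p = 2`: the `Δ = Gal(ℚ(ζ_{2^∞})/ℚ_∞)`-invariants), and (granted Ribet 1981) its kernel is finite
(`finite_ker_res_selmerInfty`). Its Pontryagin dual is `fd : X(E/K(μ_{p^∞}))_Δ → X(E/K_∞^{cyc})` with finite
cokernel. [cite: GreenbergLNM1716, §3 (restriction maps)] [cite: Ribet1981CyclotomicTorsion, Thm. 1, pp. 315–316] -/
theorem resOfLe_selmerInfty_mem_and_conj_eq (W : WeierstrassCurve K) [W.IsElliptic] (hκ : κ.IsCyclotomic)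
    {c : W.subgroupH1 p κ.kerSubgroup} (hc : c ∈ W.selmerInfty κ) :
    W.resOfLe p (ker_cyclotomicCharacter_le_kerSubgroup κ hκ) c ∈
        W.selmerGroupOver p (GaloisRep.cyclotomicCharacter K p).toMonoidHom.ker ∧
      ∀ σ ∈ κ.kerSubgroup,
        W.conjH1 p (GaloisRep.cyclotomicCharacter K p).toMonoidHom.ker σ
            (W.resOfLe p (ker_cyclotomicCharacter_le_kerSubgroup κ hκ) c) =
          W.resOfLe p (ker_cyclotomicCharacter_le_kerSubgroup κ hκ) c :=
  ⟨W.resOfLe_mem_selmerGroupOver p (ker_cyclotomicCharacter_le_kerSubgroup κ hκ) hc,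
    fun _ hσ ↦ conjH1_resOfLe_of_mem (M := W.geomPrimaryTorsion p)
      (ker_cyclotomicCharacter_le_kerSubgroup κ hκ) hσ c⟩

end Invariants

end Summit.BirchSwinnertonDyer.BirchSwinnertonDyer.Theorems.AlignedTransportAtTwoFineRoad.InfRes

end
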